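import Mathlib
import Summits.Schanuel.Schanuel.Theorems.RigidCoreSparsityTwoDefs
import Summits.Schanuel.Schanuel.Theorems.RigidCoreSparsityTwoSplitLemmas
import Literature.NumberTheory.Transcendental.PiTranscendenceMeasureMain

/-!
# Wild cusps with a `ℚ[π, π⁻¹][n]` jet carry a finite DEPTH CAP (pocket `stub_wildPiPolynomialDepthCapRay`, lead c4)

Pocket of the line `cusp-germ-schneider-sparsity` for the crux `RigidCore.SparsityTwo` (item
stmt-Schanuel-0971), atom A3 (`WildCuspAtom`).  On the cusp ray the hit function is `A(n) + g(σₙ)` with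
`σₙ = n^{-1/e} = (rayAbscissa e n)⁻¹` and an analytic tail `g`.  When the jet, as a function of `n`, is a
RATIONAL LAURENT POLYNOMIAL IN `π` times powers of `n`,
`A(n) = ∑_{m ≤ N} ∑_{|i| ≤ M} c m i · πⁱ · nᵐ` (`c m i ∈ ℚ`), and genuinely involves `π` (some `c m i ≠ 0`
with `i ≠ 0`; the class of the double-Cayley cubic of `Cruxes/SparsityTwo/Disproof.lean` §3b), the DEPTH of
the tail is capped: there is `K = K(e, M, N)` such that if `g` is flat to order `K` at `0` then only finitely
many `n` are hits `A(n) + g(σₙ) ∈ ℤ`.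

Mechanism.  Clear the denominators (`D · c m i = z m i ∈ ℤ`) and multiply by `π^M`: an exact hit
`A(n) + g(σₙ) = L ∈ ℤ` produces the INTEGER polynomial
`P = ∑∑ z m i nᵐ X^{i+M} − D L X^M ∈ ℤ[X]` of degree `≤ 2M`, length `≤ C₄ n^N`, with
`P(π) = −D π^M g(σₙ) = O(n^{−(K+1)/e})`, and `P ≠ 0` for `n` large (its `X^{i₀+M}`-coefficient is a
non-zero integer polynomial in `n`).  The transcendence measure of `π` of NESTERENKO–WALDSCHMIDT 1996,
Theorem 2 (2) — PROVED in the tree, `Literature.NumberTheory.Transcendental.NesterenkoWaldschmidt1996_thm_2_2_holds` —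
gives `|P(π)| ≥ exp(−2·10⁶ d (log L + d log d)(1 + log d)) = e^{−B} L^{−κ}` (`d = 2M`), i.e.
`|P(π)| ≥ c · n^{−Nκ}`; for `(K+1)/e ≥ N⌈κ⌉ + 2` this contradicts the flatness bound beyond an explicit `n₀`.
No unproved facts; axioms standard.  Sources: Yu. V. Nesterenko, M. Waldschmidt, Mat. Zapiski 2 (1996),
Thm 2 (2) (tree theorem); Mathlib (`AnalyticAt.exists_eq_sum_add_pow_mul`, `Polynomial.finite_setOf_isRoot`).
-/

-- `Summit.Schanuel.Schanuel.…` is the mandated summit/sub-problem namespace (single-conjunct summit), hence: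
set_option linter.dupNamespace false

namespace Summit.Schanuel.Schanuel.Cruxes.SparsityTwo.CuspGermSchneiderSparsity

open Filter Topology Complex Polynomial Literature.NumberTheory.Transcendental
open scoped Real

/-! ## Clearing denominators and the integer witness polynomial -/

/-- Common denominator of finitely many rationals `c m i`, `(m, i) ∈ s`: a natural `D ≥ 1` and integers
`z m i = D · c m i` on `s`. [folklore] -/
theorem wildPiPoly_commonDen (s : Finset (ℕ × ℤ)) (c : ℕ → ℤ → ℚ) :
    ∃ (D : ℕ) (z : ℕ → ℤ → ℤ), 1 ≤ D ∧ ∀ p ∈ s, (z p.1 p.2 : ℚ) = (D : ℚ) * c p.1 p.2 := by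
  classical
  refine ⟨∏ p ∈ s, (c p.1 p.2).den,
    fun m i => (c m i).num * (((∏ p ∈ s, (c p.1 p.2).den) / (c m i).den : ℕ) : ℤ), ?_, ?_⟩
  · exact Nat.one_le_iff_ne_zero.mpr (Finset.prod_ne_zero_iff.mpr fun p _ => (c p.1 p.2).den_nz)
  · intro p hp
    obtain ⟨k, hk⟩ := Finset.dvd_prod_of_mem (fun q : ℕ × ℤ => (c q.1 q.2).den) hp
    dsimp only
    rw [hk, Nat.mul_div_cancel_left k (c p.1 p.2).den_pos]
    push_cast
    rw [mul_comm ((c p.1 p.2).den : ℚ) (k : ℚ), mul_assoc, Rat.den_mul_eq_num]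
    ring

/-- The integer witness polynomial `P = ∑_{m ≤ N} ∑_{|i| ≤ M} z m i yᵐ X^{i+M} − T X^M` of a hit: degree
`≤ 2M`, explicit coefficients, and `P(x) = x^M (∑∑ z m i xⁱ yᵐ − T)` for `x ≠ 0`. [folklore] -/
theorem wildPiPoly_witness (M N : ℕ) (z : ℕ → ℤ → ℤ) (y T : ℤ) :
    ∃ P : ℤ[X], P.natDegree ≤ 2 * M ∧
      (∀ k, P.coeff k = (∑ m ∈ Finset.range (N + 1), ∑ i ∈ Finset.Icc (-(M : ℤ)) M,
          if k = (i + M).toNat then z m i * y ^ m else 0) - if k = M then T else 0) ∧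
      ∀ x : ℂ, x ≠ 0 → aeval x P = x ^ M * ((∑ m ∈ Finset.range (N + 1), ∑ i ∈ Finset.Icc (-(M : ℤ)) M,
          (z m i : ℂ) * x ^ i * (y : ℂ) ^ m) - T) := by
  refine ⟨(∑ m ∈ Finset.range (N + 1), ∑ i ∈ Finset.Icc (-(M : ℤ)) M,
      C (z m i * y ^ m) * X ^ (i + M).toNat) - C T * X ^ M, ?_, ?_, ?_⟩
  · refine (natDegree_sub_le _ _).trans (max_le ?_ ((natDegree_C_mul_X_pow_le _ _).trans (by omega)))
    refine natDegree_sum_le_of_forall_le _ _ fun m _ => natDegree_sum_le_of_forall_le _ _ fun i hi => ?_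
    refine (natDegree_C_mul_X_pow_le _ _).trans ?_
    rw [Finset.mem_Icc] at hi
    omega
  · intro k
    simp only [coeff_sub, finsetSum_coeff, coeff_C_mul_X_pow]
  · intro x hx
    have hxp : ∀ i ∈ Finset.Icc (-(M : ℤ)) M, x ^ (i + M).toNat = x ^ i * x ^ M := by
      intro i hi
      rw [Finset.mem_Icc] at hi
      rw [← zpow_natCast, Int.toNat_of_nonneg (by omega), zpow_add₀ hx, zpow_natCast]
    simp only [C_mul_X_pow_eq_monomial]
    simp only [map_sub, map_sum, aeval_monomial, algebraMap_int_eq, eq_intCast, Int.cast_mul, Int.cast_pow,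
      mul_sub, Finset.mul_sum]
    congr 1
    · refine Finset.sum_congr rfl fun m _ => Finset.sum_congr rfl fun i hi => ?_
      rw [hxp i hi]
      ring
    · ring

/-- The coefficient of `X^{i₀+M}` (`i₀ ≠ 0`, `|i₀| ≤ M`) of the witness polynomial is `∑_m z m i₀ yᵐ`.
[folklore] -/
theorem wildPiPoly_coeff_at (M N : ℕ) (z : ℕ → ℤ → ℤ) (y T : ℤ) {i₀ : ℤ} (hi₀ : i₀ ≠ 0)
    (hi₀' : i₀ ∈ Finset.Icc (-(M : ℤ)) M) :
    ((∑ m ∈ Finset.range (N + 1), ∑ i ∈ Finset.Icc (-(M : ℤ)) M,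
        if (i₀ + M).toNat = (i + M).toNat then z m i * y ^ m else 0) -
        if (i₀ + M).toNat = M then T else 0) =
      ∑ m ∈ Finset.range (N + 1), z m i₀ * y ^ m := by
  rw [Finset.mem_Icc] at hi₀'
  rw [if_neg (by omega), sub_zero]
  refine Finset.sum_congr rfl fun m _ => ?_
  rw [Finset.sum_eq_single i₀]
  · rw [if_pos rfl]
  · intro i hi hne
    rw [Finset.mem_Icc] at hi
    exact if_neg (by omega)
  · intro h
    exact absurd (Finset.mem_Icc.mpr hi₀') h

/-- Height of the witness polynomial: every coefficient is at most `∑∑ |z m i| |y|ᵐ + |T|`. [folklore] -/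
theorem wildPiPoly_coeff_abs_le (M N : ℕ) (z : ℕ → ℤ → ℤ) (y T : ℤ) (k : ℕ) :
    |(∑ m ∈ Finset.range (N + 1), ∑ i ∈ Finset.Icc (-(M : ℤ)) M,
        if k = (i + M).toNat then z m i * y ^ m else 0) - if k = M then T else 0| ≤
      (∑ m ∈ Finset.range (N + 1), ∑ i ∈ Finset.Icc (-(M : ℤ)) M, |z m i| * |y| ^ m) + |T| := by
  refine (abs_sub _ _).trans (add_le_add ?_ ?_)
  · refine (Finset.abs_sum_le_sum_abs _ _).trans (Finset.sum_le_sum fun m _ => ?_)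
    refine (Finset.abs_sum_le_sum_abs _ _).trans (Finset.sum_le_sum fun i _ => ?_)
    split_ifs
    · rw [abs_mul, abs_pow]
    · rw [abs_zero]; positivity
  · split_ifs
    · exact le_rfl
    · rw [abs_zero]; exact abs_nonneg _

/-- A non-zero integer polynomial `∑_{m ≤ N} a m nᵐ` (`a m₀ ≠ 0`) vanishes at only finitely many naturals `n`.
[folklore] -/
theorem wildPiPoly_eventually_ne_zero (N : ℕ) (a : ℕ → ℤ) {m₀ : ℕ} (hm₀ : m₀ ≤ N) (ha : a m₀ ≠ 0) :
    ∀ᶠ n : ℕ in atTop, (∑ m ∈ Finset.range (N + 1), a m * (n : ℤ) ^ m) ≠ 0 := by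
  set p : ℤ[X] := ∑ m ∈ Finset.range (N + 1), C (a m) * X ^ m with hp
  have hp0 : p ≠ 0 := by
    intro h
    have hc : p.coeff m₀ = a m₀ := by
      rw [hp, finsetSum_coeff]
      simp only [coeff_C_mul_X_pow]
      rw [Finset.sum_ite_eq, if_pos (Finset.mem_range.mpr (by omega))]
    rw [h, coeff_zero] at hc
    exact ha hc.symm
  have heval : ∀ n : ℕ, p.eval (n : ℤ) = ∑ m ∈ Finset.range (N + 1), a m * (n : ℤ) ^ m := by
    intro n
    simp [hp, eval_finsetSum]
  have hfin : {n : ℕ | p.IsRoot (n : ℤ)}.Finite :=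
    (finite_setOf_isRoot hp0).preimage Nat.cast_injective.injOn
  have h := hfin.eventually_cofinite_notMem
  rw [Nat.cofinite_eq_atTop] at h
  filter_upwards [h] with n hn
  rwa [IsRoot.def, heval] at hn

/-! ## The two real-variable estimates -/

/-- The Nesterenko–Waldschmidt exponent dominates `e^{-B} L^{-A'}` when `κ = 2·10⁶ d (1 + log d) ≤ A'`,
`B = κ · d log d`, `L ≥ 1`. [folklore] -/
theorem wildPiPoly_nw_exponent {d L A' : ℕ} (hL : 1 ≤ L)
    (hA' : 2 * 10 ^ 6 * (d : ℝ) * (1 + Real.log d) ≤ A') :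
    Real.exp (-(2 * 10 ^ 6 * (d : ℝ) * (1 + Real.log d) * (d * Real.log d))) / (L : ℝ) ^ A' ≤
      Real.exp (-(2 * 10 ^ 6 * (d : ℝ) * (Real.log L + d * Real.log d) * (1 + Real.log d))) := by
  have hL0 : (0 : ℝ) < L := by exact_mod_cast hL
  have hlogL : 0 ≤ Real.log L := Real.log_nonneg (by exact_mod_cast hL)
  rw [div_le_iff₀ (by positivity), ← Real.exp_log (pow_pos hL0 A'), ← Real.exp_add, Real.exp_le_exp,
    Real.log_pow]
  have hlogd : 0 ≤ Real.log d := Real.log_natCast_nonneg d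
  have hd0 : (0 : ℝ) ≤ d := Nat.cast_nonneg d
  nlinarith [mul_le_mul_of_nonneg_right hA' hlogL, mul_nonneg hd0 hlogd]

/-- Final comparison: `e^{-B} / (C₄ n^N)^{A'} ≤ G / n^{N A' + 2}` is impossible once `n > e^{B} G C₄^{A'}`,
`n ≥ 1`. [folklore] -/
theorem wildPiPoly_arith {N A' : ℕ} {n B G C₄ : ℝ} (hn : 1 ≤ n) (hC₄ : 0 < C₄)
    (hle : Real.exp (-B) / (C₄ * n ^ N) ^ A' ≤ G / n ^ (N * A' + 2))
    (hbig : Real.exp B * G * C₄ ^ A' < n) : False := by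
  have hn0 : 0 < n := by linarith
  have hE := Real.exp_pos (-B)
  rw [div_le_div_iff₀ (by positivity) (by positivity)] at hle
  have h1 : Real.exp (-B) * n ^ (N * A' + 2) = (Real.exp (-B) * n ^ 2) * n ^ (N * A') := by ring
  have h2 : G * (C₄ * n ^ N) ^ A' = (G * C₄ ^ A') * n ^ (N * A') := by rw [mul_pow, ← pow_mul]; ring
  rw [h1, h2] at hle
  have h3 : Real.exp (-B) * n ^ 2 ≤ G * C₄ ^ A' := le_of_mul_le_mul_right hle (by positivity)
  have h5 : Real.exp B * (Real.exp (-B) * n ^ 2) = n ^ 2 := by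
    rw [← mul_assoc, ← Real.exp_add, add_neg_cancel, Real.exp_zero, one_mul]
  have h6 : n ^ 2 ≤ Real.exp B * (G * C₄ ^ A') := by
    rw [← h5]; exact mul_le_mul_of_nonneg_left h3 (Real.exp_pos B).le
  nlinarith

/-! ## The pocket -/

/-- **stub_wildPiPolynomialDepthCapRay** (POCKET "π-polynomial depth cap" of the WILD cusp; registered stub,
signature verbatim).  For `e ≥ 1` and rational coefficients `c m i` (`m ≤ N`, `|i| ≤ M`) with some
`c m i ≠ 0`, `i ≠ 0`, there is `K : ℕ` such that for every `g` analytic at `0` and flat to order `K`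
the set of `n : ℕ` with `∑_{m ≤ N} ∑_{|i| ≤ M} c m i πⁱ nᵐ + g(n^{-1/e}) ∈ ℤ` is finite.  Proof: with
`d = 2M`, `κ = 2·10⁶ d (1 + log d)`, `K + 1 = e (N⌈κ⌉ + 2)`, a late hit gives a non-zero `P ∈ ℤ[X]`,
`deg P ≤ d`, length `≤ C₄ n^N`, `|P(π)| = D π^M |g(σₙ)| ≤ G n^{-(N⌈κ⌉+2)}`, against Nesterenko–Waldschmidt
`|P(π)| ≥ e^{-B} (C₄ n^N)^{-⌈κ⌉}` (`NesterenkoWaldschmidt1996_thm_2_2_holds`). -/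
theorem stub_wildPiPolynomialDepthCapRay :
    ∀ (e M N : ℕ) (c : ℕ → ℤ → ℚ), 0 < e →
      (∃ m : ℕ, ∃ i : ℤ, m ≤ N ∧ i ≠ 0 ∧ -(M : ℤ) ≤ i ∧ i ≤ M ∧ c m i ≠ 0) →
      ∃ K : ℕ, ∀ g : ℂ → ℂ, AnalyticAt ℂ g 0 →
        (∀ i : ℕ, i ≤ K → iteratedDeriv i g 0 = 0) →
        Set.Finite {n : ℕ | ∃ L : ℤ,
          (∑ m ∈ Finset.range (N + 1), ∑ i ∈ Finset.Icc (-(M : ℤ)) M,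
              (c m i : ℂ) * (Real.pi : ℂ) ^ i * (n : ℂ) ^ m) + g (rayAbscissa e n)⁻¹ = L} := by
  intro e M N c he hne
  obtain ⟨m₀, i₀, hm₀, hi₀, hi₀l, hi₀u, hc₀⟩ := hne
  classical
  -- clear denominators: `z m i = D · c m i`
  obtain ⟨D, z, hD1, hz⟩ := wildPiPoly_commonDen (Finset.range (N + 1) ×ˢ Finset.Icc (-(M : ℤ)) M) c
  have hM1 : 1 ≤ M := by omega
  -- constants independent of `g`: `d = 2M`, `κ`, `A' = ⌈κ⌉`, `J = N A' + 2`, `K + 1 = e J`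
  obtain ⟨d, hd⟩ : ∃ d : ℕ, d = 2 * M := ⟨_, rfl⟩
  obtain ⟨κ, hκ⟩ : ∃ κ : ℝ, κ = 2 * 10 ^ 6 * (d : ℝ) * (1 + Real.log d) := ⟨_, rfl⟩
  obtain ⟨A', hA'⟩ : ∃ A' : ℕ, A' = ⌈κ⌉₊ := ⟨_, rfl⟩
  obtain ⟨J, hJ⟩ : ∃ J : ℕ, J = N * A' + 2 := ⟨_, rfl⟩
  obtain ⟨B, hB⟩ : ∃ B : ℝ, B = κ * (d * Real.log d) := ⟨_, rfl⟩
  have heJ : 1 ≤ e * J := Nat.mul_pos he (by omega)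
  refine ⟨e * J - 1, ?_⟩
  intro g hg hflat
  -- Taylor: `g w = w^{eJ} F w`
  obtain ⟨F, hF, hgeq⟩ := hg.exists_eq_sum_add_pow_mul (e * J)
  have hgeq' : ∀ w, g w = w ^ (e * J) * F w := by
    intro w
    rw [hgeq w, Finset.sum_eq_zero, zero_add, smul_eq_mul]
    intro i hi
    rw [Finset.mem_range] at hi
    rw [hflat i (by omega), smul_zero]
  have hg0 : g 0 = 0 := by simpa using hflat 0 (Nat.zero_le _)
  -- the ray points `σₙ → 0`
  have hσ : Tendsto (fun n : ℕ => (rayAbscissa e n)⁻¹) atTop (𝓝 0) := by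
    simp only [rayAbscissa]
    exact (tendsto_rayPoint_nhdsNE he).mono_right nhdsWithin_le_nhds
  have hFb : ∀ᶠ n : ℕ in atTop, ‖F (rayAbscissa e n)⁻¹‖ ≤ ‖F 0‖ + 1 :=
    (hF.continuousAt.tendsto.comp hσ).norm.eventually (eventually_le_nhds (lt_add_one _))
  have hgb : ∀ᶠ n : ℕ in atTop, ‖g (rayAbscissa e n)⁻¹‖ ≤ 1 := by
    have h := (hg.continuousAt.tendsto.comp hσ).norm
    rw [hg0, norm_zero] at h
    exact h.eventually (eventually_le_nhds one_pos)
  -- the `X^{i₀+M}`-coefficient `∑ z m i₀ nᵐ` is eventually non-zero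
  have hpn : ∀ᶠ n : ℕ in atTop, (∑ m ∈ Finset.range (N + 1), z m i₀ * (n : ℤ) ^ m) ≠ 0 := by
    refine wildPiPoly_eventually_ne_zero N (fun m => z m i₀) hm₀ ?_
    intro h0
    have h := hz (m₀, i₀) (Finset.mem_product.mpr ⟨Finset.mem_range.mpr (by omega), Finset.mem_Icc.mpr ⟨hi₀l, hi₀u⟩⟩)
    simp only at h
    rw [h0, Int.cast_zero] at h
    have hD0 : (D : ℚ) ≠ 0 := by exact_mod_cast (show D ≠ 0 by omega)
    exact hc₀ ((mul_eq_zero.mp h.symm).resolve_left hD0)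
  -- size constants
  obtain ⟨Cc, hCc⟩ : ∃ Cc : ℝ,
      Cc = ∑ m ∈ Finset.range (N + 1), ∑ i ∈ Finset.Icc (-(M : ℤ)) M, |(c m i : ℝ)| * π ^ i := ⟨_, rfl⟩
  obtain ⟨Zr, hZr⟩ : ∃ Zr : ℝ,
      Zr = ∑ m ∈ Finset.range (N + 1), ∑ i ∈ Finset.Icc (-(M : ℤ)) M, |(z m i : ℝ)| := ⟨_, rfl⟩
  have hCc0 : 0 ≤ Cc := by
    rw [hCc]
    exact Finset.sum_nonneg fun m _ => Finset.sum_nonneg fun i _ =>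
      mul_nonneg (abs_nonneg _) (zpow_pos Real.pi_pos _).le
  have hZr0 : 0 ≤ Zr := by rw [hZr]; positivity
  obtain ⟨C₄, hC₄⟩ : ∃ C₄ : ℕ, C₄ = ⌈(2 * M + 1 : ℝ) * (Zr + D * (Cc + 1))⌉₊ + 3 := ⟨_, rfl⟩
  obtain ⟨G, hG⟩ : ∃ G : ℝ, G = D * π ^ M * (‖F 0‖ + 1) := ⟨_, rfl⟩
  have hC₄pos : (0 : ℝ) < C₄ := by rw [hC₄]; positivity
  /- KEY: no late hits -/
  have key : ∀ᶠ n : ℕ in atTop, ∀ L : ℤ,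
      (∑ m ∈ Finset.range (N + 1), ∑ i ∈ Finset.Icc (-(M : ℤ)) M,
          (c m i : ℂ) * (Real.pi : ℂ) ^ i * (n : ℂ) ^ m) + g (rayAbscissa e n)⁻¹ ≠ L := by
    filter_upwards [hFb, hgb, hpn, eventually_ge_atTop 1,
      (tendsto_natCast_atTop_atTop (R := ℝ)).eventually_gt_atTop (Real.exp B * G * (C₄ : ℝ) ^ A')]
      with n hFn hgn hpn' hn1 hnbig L hL
    have hn1R : (1 : ℝ) ≤ n := by exact_mod_cast hn1
    set σ : ℂ := (rayAbscissa e n)⁻¹ with hσdef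
    set S : ℂ := ∑ m ∈ Finset.range (N + 1), ∑ i ∈ Finset.Icc (-(M : ℤ)) M,
      (c m i : ℂ) * (Real.pi : ℂ) ^ i * (n : ℂ) ^ m with hSdef
    -- `‖σ‖^{eJ} = n^{-J}` and the flatness bound
    have hσnorm : ‖σ‖ ^ (e * J) = ((n : ℝ) ^ J)⁻¹ := by
      have h1 : ‖rayAbscissa e n‖ ^ e = n := by
        rw [← norm_pow, rayAbscissa, rayAbscissa_pow he n, Complex.norm_natCast]
      rw [hσdef, norm_inv, inv_pow, pow_mul, h1]
    have hgσ : ‖g σ‖ ≤ (‖F 0‖ + 1) * ((n : ℝ) ^ J)⁻¹ := by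
      rw [hgeq' σ, norm_mul, norm_pow, hσnorm, mul_comm]
      exact mul_le_mul_of_nonneg_right hFn (by positivity)
    -- `|L| ≤ Cc n^N + 1`
    have hSn : ‖S‖ ≤ Cc * (n : ℝ) ^ N := by
      calc ‖S‖ ≤ ∑ m ∈ Finset.range (N + 1), ‖∑ i ∈ Finset.Icc (-(M : ℤ)) M,
              (c m i : ℂ) * (Real.pi : ℂ) ^ i * (n : ℂ) ^ m‖ := norm_sum_le _ _
        _ ≤ ∑ m ∈ Finset.range (N + 1), ∑ i ∈ Finset.Icc (-(M : ℤ)) M, |(c m i : ℝ)| * π ^ i * (n : ℝ) ^ N := by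
            refine Finset.sum_le_sum fun m hm => (norm_sum_le _ _).trans (Finset.sum_le_sum fun i _ => ?_)
            rw [norm_mul, norm_mul, Complex.norm_ratCast, Complex.norm_zpow, Complex.norm_real, Real.norm_eq_abs,
              abs_of_pos Real.pi_pos, norm_pow, Complex.norm_natCast]
            have hm' : m ≤ N := by rw [Finset.mem_range] at hm; omega
            exact mul_le_mul_of_nonneg_left (pow_le_pow_right₀ hn1R hm')
              (mul_nonneg (abs_nonneg _) (zpow_pos Real.pi_pos _).le)
        _ = Cc * (n : ℝ) ^ N := by
            rw [hCc, Finset.sum_mul]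
            exact Finset.sum_congr rfl fun m _ => by rw [Finset.sum_mul]
    have hLabs : |(L : ℝ)| ≤ Cc * (n : ℝ) ^ N + 1 := by
      rw [← Complex.norm_intCast, ← hL]
      exact (norm_add_le _ _).trans (add_le_add hSn hgn)
    -- the witness polynomial, its value at `π`, non-vanishing, degree, length
    obtain ⟨P, hPdeg, hPcoeff, hPeval⟩ := wildPiPoly_witness M N z n (D * L)
    have hzc : ∀ m ∈ Finset.range (N + 1), ∀ i ∈ Finset.Icc (-(M : ℤ)) M,
        (z m i : ℂ) = (D : ℂ) * (c m i : ℂ) := by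
      intro m hm i hi
      have h := hz (m, i) (Finset.mem_product.mpr ⟨hm, hi⟩)
      have h' := congrArg (fun q : ℚ => (q : ℂ)) h
      simpa only [Rat.cast_intCast, Rat.cast_mul, Rat.cast_natCast] using h'
    have hPπ : aeval (Real.pi : ℂ) P = -((D : ℂ) * (Real.pi : ℂ) ^ M * g σ) := by
      rw [hPeval _ (by exact_mod_cast Real.pi_ne_zero)]
      have hDS : (∑ m ∈ Finset.range (N + 1), ∑ i ∈ Finset.Icc (-(M : ℤ)) M,
          (z m i : ℂ) * (Real.pi : ℂ) ^ i * ((n : ℤ) : ℂ) ^ m) = (D : ℂ) * S := by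
        rw [hSdef, Finset.mul_sum]
        refine Finset.sum_congr rfl fun m hm => ?_
        rw [Finset.mul_sum]
        refine Finset.sum_congr rfl fun i hi => ?_
        rw [hzc m hm i hi, Int.cast_natCast]
        ring
      rw [hDS]
      have hgL : g σ = (L : ℂ) - S := by rw [← hL]; ring
      rw [hgL]
      push_cast
      ring
    have hPπnorm : ‖aeval (Real.pi : ℂ) P‖ = (D : ℝ) * π ^ M * ‖g σ‖ := by
      rw [hPπ, norm_neg, norm_mul, norm_mul, norm_pow, Complex.norm_natCast, Complex.norm_real,
        Real.norm_eq_abs, abs_of_pos Real.pi_pos]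
    have hP0 : P ≠ 0 := by
      intro h0
      have hc := hPcoeff (i₀ + M).toNat
      rw [h0, coeff_zero, wildPiPoly_coeff_at M N z n (D * L) hi₀ (Finset.mem_Icc.mpr ⟨hi₀l, hi₀u⟩)] at hc
      exact hpn' hc.symm
    have hlenZ : (∑ k ∈ Finset.range (P.natDegree + 1), |P.coeff k|) ≤
        ((2 * M + 1 : ℕ) : ℤ) * ((∑ m ∈ Finset.range (N + 1), ∑ i ∈ Finset.Icc (-(M : ℤ)) M,
          |z m i| * |(n : ℤ)| ^ m) + |(D : ℤ) * L|) := by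
      calc (∑ k ∈ Finset.range (P.natDegree + 1), |P.coeff k|)
          ≤ ∑ k ∈ Finset.range (2 * M + 1), |P.coeff k| :=
            Finset.sum_le_sum_of_subset_of_nonneg (Finset.range_subset_range.mpr (by omega))
              fun _ _ _ => abs_nonneg _
        _ ≤ ∑ k ∈ Finset.range (2 * M + 1), ((∑ m ∈ Finset.range (N + 1), ∑ i ∈ Finset.Icc (-(M : ℤ)) M,
              |z m i| * |(n : ℤ)| ^ m) + |(D : ℤ) * L|) :=
            Finset.sum_le_sum fun k _ => by rw [hPcoeff k]; exact wildPiPoly_coeff_abs_le M N z n (D * L) k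
        _ = _ := by rw [Finset.sum_const, Finset.card_range, nsmul_eq_mul]
    have hlenR : ((((2 * M + 1 : ℕ) : ℤ) * ((∑ m ∈ Finset.range (N + 1), ∑ i ∈ Finset.Icc (-(M : ℤ)) M,
          |z m i| * |(n : ℤ)| ^ m) + |(D : ℤ) * L|) : ℤ) : ℝ) ≤ ((C₄ * n ^ N : ℕ) : ℝ) := by
      push_cast
      have h1 : (∑ m ∈ Finset.range (N + 1), ∑ i ∈ Finset.Icc (-(M : ℤ)) M, |(z m i : ℝ)| * |(n : ℝ)| ^ m) ≤
          Zr * (n : ℝ) ^ N := by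
        rw [hZr, Finset.sum_mul]
        refine Finset.sum_le_sum fun m hm => ?_
        rw [Finset.sum_mul]
        refine Finset.sum_le_sum fun i _ => ?_
        rw [Nat.abs_cast]
        have hm' : m ≤ N := by rw [Finset.mem_range] at hm; omega
        exact mul_le_mul_of_nonneg_left (pow_le_pow_right₀ hn1R hm') (abs_nonneg _)
      have hnN1 : (1 : ℝ) ≤ (n : ℝ) ^ N := one_le_pow₀ hn1R
      have h2 : |(D : ℝ) * (L : ℝ)| ≤ D * (Cc + 1) * (n : ℝ) ^ N := by
        rw [abs_mul, Nat.abs_cast]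
        calc (D : ℝ) * |(L : ℝ)| ≤ D * (Cc * (n : ℝ) ^ N + 1) := by gcongr
          _ ≤ D * (Cc * (n : ℝ) ^ N + (n : ℝ) ^ N) := by gcongr
          _ = D * (Cc + 1) * (n : ℝ) ^ N := by ring
      have h3 : (2 * (M : ℝ) + 1) * (Zr + D * (Cc + 1)) + 3 ≤ (C₄ : ℝ) := by
        rw [hC₄]
        push_cast
        linarith [Nat.le_ceil ((2 * M + 1 : ℝ) * (Zr + D * (Cc + 1)))]
      have hnN0 : (0 : ℝ) ≤ (n : ℝ) ^ N := by positivity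
      calc (2 * (M : ℝ) + 1) * ((∑ m ∈ Finset.range (N + 1), ∑ i ∈ Finset.Icc (-(M : ℤ)) M,
              |(z m i : ℝ)| * |(n : ℝ)| ^ m) + |(D : ℝ) * (L : ℝ)|)
          ≤ (2 * (M : ℝ) + 1) * (Zr * (n : ℝ) ^ N + D * (Cc + 1) * (n : ℝ) ^ N) := by gcongr
        _ = ((2 * (M : ℝ) + 1) * (Zr + D * (Cc + 1))) * (n : ℝ) ^ N := by ring
        _ ≤ (C₄ : ℝ) * (n : ℝ) ^ N := mul_le_mul_of_nonneg_right (by linarith) hnN0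
    have hlen : (∑ k ∈ Finset.range (P.natDegree + 1), |P.coeff k|) ≤ ((C₄ * n ^ N : ℕ) : ℤ) :=
      hlenZ.trans (by exact_mod_cast hlenR)
    have hd1 : 1 ≤ d := by omega
    have hnN1 : 1 ≤ n ^ N := Nat.one_le_pow _ _ hn1
    have hL3 : 3 ≤ C₄ * n ^ N := by
      calc 3 ≤ C₄ := by omega
        _ = C₄ * 1 := (mul_one _).symm
        _ ≤ C₄ * n ^ N := Nat.mul_le_mul_left _ hnN1
    -- NESTERENKO–WALDSCHMIDT
    have hNW := NesterenkoWaldschmidt1996_thm_2_2_holds P d (C₄ * n ^ N) hP0 hd1 (by omega) hlen hL3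
    have hA'κ : 2 * 10 ^ 6 * (d : ℝ) * (1 + Real.log d) ≤ A' := by
      rw [hA', ← hκ]
      exact Nat.le_ceil κ
    have hlow := wildPiPoly_nw_exponent (d := d) (L := C₄ * n ^ N) (A' := A') (by omega) hA'κ
    have hchain : Real.exp (-B) / ((C₄ : ℝ) * (n : ℝ) ^ N) ^ A' ≤ G / (n : ℝ) ^ (N * A' + 2) := by
      have h1 : Real.exp (-B) / ((C₄ : ℝ) * (n : ℝ) ^ N) ^ A' ≤ ‖aeval (Real.pi : ℂ) P‖ := by
        have h := hlow.trans hNW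
        rw [hB, hκ]
        push_cast at h
        exact h
      have h2 : ‖aeval (Real.pi : ℂ) P‖ ≤ G / (n : ℝ) ^ (N * A' + 2) := by
        rw [hPπnorm, hG, ← hJ, div_eq_mul_inv]
        calc (D : ℝ) * π ^ M * ‖g σ‖ ≤ D * π ^ M * ((‖F 0‖ + 1) * ((n : ℝ) ^ J)⁻¹) := by gcongr
          _ = _ := by ring
      exact h1.trans h2
    exact wildPiPoly_arith hn1R hC₄pos hchain hnbig
  /- finitely many hits -/
  obtain ⟨n₀, hn₀⟩ := eventually_atTop.mp key
  refine (Set.finite_lt_nat n₀).subset ?_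
  rintro n ⟨L, hL⟩
  by_contra h
  exact hn₀ n (not_lt.mp h) L hL

end Summit.Schanuel.Schanuel.Cruxes.SparsityTwo.CuspGermSchneiderSparsity
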